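import Summits.CriticalPhenomena.PercolationContinuityZ3.Theorems.PercNearOneGluingNoHeavyQuantTorqueCost
import HarnessLib

/-!
# QUANT lane R8, T-DEC: THE PROPORTIONAL FAN CRITERION — any number of positive low atoms, any finite set of COST-SAFE routes: if every
# charged low spreads over its fan proportionally to the capacities `μ(h)/κ(l,h)` and the LOAD SUM `Σ_l μ(l)/C(l)` is at most `1`, the law is
# DEC at EVERY layer (k-free, width-free wrapper for the transport regime; census-1 gen 28)

builds on p205010 (kernel theorem, internal audit signed; external expert review pending)

Support file (`--supports stmt-CriticalPhenomena-4575`), QUANT lane seat prim-quant-census-1 (gen 28), rung R8 of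
`run/shared/lean/prim/quant/LADDER.md`; memo `run/shared/lean/prim/quant/prim-quant-census-1/g28/FAN-G28.md`.  Theorems only (no definitions),
standard axioms, no sorries.  A corollary of arm-1 g50's torque-cost machinery in its cost-free form `flowAtT_of_safeTransport`
(`…QuantTorqueCost`, ✓ p451307): every route used is cost-safe, so only CAPACITY is checked.

THE CRITERION.  A probability law `μ` on `{0..M}`, mean `T > 0`, floor `0 < y < 1`, `y·M ≤ T`.  A finite set `R` of ROUTES `(l, h)` — `l` a positive
low atom (`1 ≤ l`, `2l < T`), `h` a compatible absorber (`l < h ≤ M`, `T < l + h`) that is COST-SAFE for `l` (`y·(h − l) ≤ T − l`; every credit route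
`h ≤ l + (T − 2l)/y` and every far route up to `l + (T − l)/y` qualifies, `freeRate_torque_le`).  The FAN of `l` is `{h : (l,h) ∈ R}`; its CAPACITY in units
of `l`-mass is `C(l) = Σ_{(l,h) ∈ R} μ(h)/κ(l,h)`, `κ = freeRate y T l h = γ/(1−γ)`, `γ = max(y, (T−2l)/(h−l))` (the layer-free rate).  Ship every
charged positive low `l` over its fan PROPORTIONALLY to the capacities: `f(l,h) = μ(l)·(μ(h)/κ(l,h))/C(l)`.  The load on an absorber `h` is then
`μ(h)·Σ_{l : (l,h) ∈ R} μ(l)/C(l)`, so the single inequality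
  **LOAD SUM `Σ_{l positive low, charged} μ(l)/C(l) ≤ 1`**
makes the transport feasible at every absorber simultaneously; cost-safety makes the torque bookkeeping automatic; hence `DECAt y j′ M μ` for
every `j′ < M` (**`decAt_all_of_propFan`**).  The SINGLE-LOW case (`2 < T ≤ 4`: the only positive low atom is `1`) reads: for any finite set `H` of
cost-safe compatible absorbers, **`μ(1) ≤ Σ_{h ∈ H} μ(h)/κ(1,h)`** ⟹ DEC at every layer (**`decAt_all_of_oneLowFan`**) — arm-1 g54's
`decAt_all_of_oneRoute` is `H = {h₁}` (there with an optional costly route), the aggregate rules `1 → {3,4}`, `1 → {4,5}` of ARCH-G54 §5 are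
`H = {3,4}`, `{4,5}`, and the k-general rule "all cost-safe routes" is `H = {h : T < 1+h ≤ M+1, y(h−1) ≤ T−1}`.

WHY (memo FAN-G28 §2–§3; kit j276490, evidence on stmt-4575: 10 277 random forests of 2-chains `R[qᵢ](R[pᵢ])`, widths `k = 3..24`, every gate with
`2 < T ≤ 6`, true and top-affordable floors, exact rationals for `k ≤ 12`).  In the single-low regime `2 < T ≤ 4` the all-cost-safe fan is feasible at
EVERY row (≈ 236 000; worst load `0.48` at `k = 3`, `0.26` at `k = 4–6`, `0.13` at `k ≥ 16` — width HELPS), while every TWO-absorber rule fails for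
some width (`1 → {3,4}` at `k ≥ 4`, `3 < T ≤ 4`; `1 → {3}` / `1 → {3,4,5}` at `k = 3`); the layer-free torque criterion with LP-optimal routes has
0 failures in all regimes `T ≤ 6`.  The same census shows that arm-1 g49's BUDGET criterion (`decAt_all_of_budget`) already certifies every sampled row of
width `k ≥ 8` and all but a few dozen of widths `4–6` (all at `T > 4`); the fan form is what the width-3 residue and a k-general proof of the conjectured
capacity inequality `(s − 2)·f₁ ≤ (4 − s)·f₃` (memo §4; worst ratio `0.81`, Poisson-limit margin `1/8`) would consume — this file is that wrapper, k-free.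

* `freeRate_pos` (the layer-free rate is positive on compatible routes);
* **`decAt_all_of_propFan`** (any number of lows, load sum ≤ 1), **`decAt_all_of_oneLowFan`** (`2 < T ≤ 4`, one capacity inequality).

HONEST STATUS: sufficient conditions (certificate infrastructure), law level; `SiblingStep` ⟺ `GateStepN`, `LightResidDECOracle`, `FarTreeRow` OPEN; the
RATE class (log\*) and the honest sentence of `run/shared/lean/prim/quant/README.md` are unchanged.  [this work]; torque machinery prim-quant-arm-1
g49/g50/g54.  Transportation problems with gains are classical; nothing here is cited as a published result.  The gluing rows served
[cite: KozmaNitzan2024, Conjecture 3 (p. 15)]; product measure [cite: Grimmett1999, §1.3 p. 10].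
-/

noncomputable section

open scoped BigOperators

namespace Summit.CriticalPhenomena.PercolationContinuityZ3.Theorems
namespace Quant
namespace LawDec

open Finset

/-! ### The layer-free rate is positive on compatible routes -/

/-- on a compatible route (`2l < T < l + h`, `l < h`, `0 < y < 1`) the layer-free rate `κ = γ/(1−γ)` is POSITIVE (`γ ≥ y > 0`, `γ < 1`). [this work] -/
theorem freeRate_pos (y T : ℝ) (l h : ℕ) (hy0 : 0 < y) (hy1 : y < 1) (hlow : 2 * (l : ℝ) < T) (hlh : l < h)
    (hcomp : T < (l : ℝ) + h) : 0 < freeRate y T l h := by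
  unfold freeRate
  have hhl : (0 : ℝ) < (h : ℝ) - l := by
    have : (l : ℝ) < h := by exact_mod_cast hlh
    linarith
  have hρ1 : (T - 2 * (l : ℝ)) / ((h : ℝ) - l) < 1 := by rw [div_lt_one hhl]; linarith
  have hγ1 : max y ((T - 2 * (l : ℝ)) / ((h : ℝ) - l)) < 1 := max_lt hy1 hρ1
  exact div_pos (lt_of_lt_of_le hy0 (le_max_left _ _)) (by linarith)

/-! ### The proportional fan criterion -/

/-- **THE PROPORTIONAL FAN CRITERION (any number of positive low atoms).**  A probability law `μ` on `{0..M}` with mean `T > 0`, floor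
`0 < y < 1`, `y·M ≤ T`; a finite set `R` of cost-safe compatible routes `(l, h)` (`1 ≤ l`, `2l < T`, `l < h ≤ M`, `T < l + h`, `y·(h − l) ≤ T − l`);
capacities `C(l) = Σ_{(l,h) ∈ R} μ(h)/freeRate(l,h)`.  If every CHARGED positive low atom has positive capacity and the LOAD SUM over the positive
low atoms `Σ_l μ(l)/C(l)` is at most `1`, then `μ` is DEC at floor `y` at every layer `j′ < M`. [this work] -/
theorem decAt_all_of_propFan (y : ℝ) (M : ℕ) (μ : ℕ → ℝ) (T : ℝ) (R : Finset (ℕ × ℕ)) (hy0 : 0 < y) (hy1 : y < 1)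
    (hμ0 : ∀ h, 0 ≤ μ h) (hμM : ∀ h, M < h → μ h = 0) (hμ1 : ∑ h ∈ Finset.range (M + 1), μ h = 1)
    (hT : ∑ h ∈ Finset.range (M + 1), (h : ℝ) * μ h = T) (hT0 : 0 < T) (hta : y * (M : ℝ) ≤ T)
    (hR : ∀ p ∈ R, 1 ≤ p.1 ∧ 2 * (p.1 : ℝ) < T ∧ p.1 < p.2 ∧ p.2 ≤ M ∧ T < (p.1 : ℝ) + p.2 ∧ y * ((p.2 : ℝ) - p.1) ≤ T - p.1)
    (hcov : ∀ l : ℕ, 1 ≤ l → 2 * (l : ℝ) < T → 0 < μ l →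
      0 < ∑ p ∈ R, (if p.1 = l then μ p.2 / freeRate y T p.1 p.2 else 0))
    (hload : ∑ l ∈ Finset.range (M + 1),
      (if (1 ≤ l ∧ 2 * (l : ℝ) < T) then μ l / ∑ p ∈ R, (if p.1 = l then μ p.2 / freeRate y T p.1 p.2 else 0) else 0) ≤ 1) :
    ∀ j', j' < M → DECAt y j' M μ := by
  classical
  -- capacities and the transport
  set C : ℕ → ℝ := fun l => ∑ p ∈ R, (if p.1 = l then μ p.2 / freeRate y T p.1 p.2 else 0) with hC
  set f : ℕ → ℕ → ℝ := fun l h => if (l, h) ∈ R then μ l * (μ h / freeRate y T l h) / C l else 0 with hf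
  have hκ0 : ∀ p ∈ R, 0 < freeRate y T p.1 p.2 := fun p hp =>
    freeRate_pos y T p.1 p.2 hy0 hy1 (hR p hp).2.1 (hR p hp).2.2.1 (hR p hp).2.2.2.2.1
  have hC0 : ∀ l, 0 ≤ C l := fun l => Finset.sum_nonneg fun p hp => by
    split_ifs
    · exact div_nonneg (hμ0 _) (hκ0 p hp).le
    · exact le_rfl
  have hf0 : ∀ l h, 0 ≤ f l h := fun l h => by
    simp only [hf]
    split_ifs with hp
    · exact div_nonneg (mul_nonneg (hμ0 l) (div_nonneg (hμ0 h) (hκ0 (l, h) hp).le)) (hC0 l)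
    · exact le_rfl
  -- the share of low `l` is `w l = μ l / C l` (zero when `l` is uncharged)
  have hshare : ∀ l h, (l, h) ∈ R → freeRate y T l h * f l h = μ h * (μ l / C l) := by
    intro l h hp
    simp only [hf, if_pos hp]
    have hκ := (hκ0 (l, h) hp).ne'
    field_simp
  intro j' hj'
  have hmom : T * ∑ h ∈ Finset.range (M + 1), μ h ≤ ∑ h ∈ Finset.range (M + 1), (h : ℝ) * μ h := by
    rw [hμ1, hT, mul_one]
  rw [decAt_iff_decAtT, hT]
  refine decAtT_of_flowAtT y T j' M μ hy0 hy1 hμM hμ1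
    (flowAtT_of_safeTransport y T j' M μ f hy0 hy1 hT0 hj' hμ0 hμM hta hmom hf0 ?_ ?_ ?_)
  · -- support
    intro l h hpos
    have hp : (l, h) ∈ R := by
      by_contra hnp
      simp only [hf, if_neg hnp] at hpos
      exact lt_irrefl 0 hpos
    obtain ⟨h1, h2, h3, h4, h5, h6⟩ := hR (l, h) hp
    exact ⟨h1, h2, h3, h4, h5, h6⟩
  · -- rows: a charged low ships exactly its mass
    intro l hl1 hlow
    rcases (hμ0 l).eq_or_lt with hz | hpos
    · -- uncharged: every `f l h` vanishes
      rw [← hz]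
      refine Finset.sum_eq_zero fun h _ => ?_
      simp only [hf]
      split_ifs
      · rw [← hz]; ring
      · rfl
    · have hCl : 0 < C l := hcov l hl1 hlow hpos
      have hrow : ∀ h ∈ Finset.range (M + 1), f l h = (μ l / C l) * (if (l, h) ∈ R then μ h / freeRate y T l h else 0) := by
        intro h _
        simp only [hf]
        split_ifs
        · field_simp
        · ring
      rw [Finset.sum_congr rfl hrow, ← Finset.mul_sum]
      -- the inner sum is `C l`: routes of `l` all have `h ≤ M`
      have hinner : ∑ h ∈ Finset.range (M + 1), (if (l, h) ∈ R then μ h / freeRate y T l h else 0) = C l := by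
        simp only [hC]
        rw [← Finset.sum_filter]
        rw [show ∑ p ∈ R, (if p.1 = l then μ p.2 / freeRate y T p.1 p.2 else 0)
            = ∑ p ∈ R.filter (fun p => p.1 = l), μ p.2 / freeRate y T p.1 p.2 from (Finset.sum_filter _ _).symm]
        refine Finset.sum_bij' (fun h _ => (l, h)) (fun p _ => p.2) ?_ ?_ ?_ ?_ ?_
        · intro h hh
          rw [Finset.mem_filter] at hh ⊢
          exact ⟨hh.2, rfl⟩
        · intro p hp
          rw [Finset.mem_filter] at hp ⊢
          obtain ⟨hpR, hpl⟩ := hp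
          have hp' : (l, p.2) ∈ R := by rw [← hpl]; exact hpR
          exact ⟨Finset.mem_range.2 (by have := (hR _ hpR).2.2.2.1; omega), hp'⟩
        · intro h _; rfl
        · intro p hp
          rw [Finset.mem_filter] at hp
          obtain ⟨_, hpl⟩ := hp
          ext <;> simp [hpl]
        · intro h _; rfl
      rw [hinner, div_mul_cancel₀ _ hCl.ne']
  · -- capacities: the load on `h` is `μ h · Σ_l μ l / C l ≤ μ h`
    intro h _
    have hterm : ∀ l ∈ Finset.range (M + 1), freeRate y T l h * f l h
        = μ h * (if (l, h) ∈ R then μ l / C l else 0) := by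
      intro l _
      by_cases hp : (l, h) ∈ R
      · rw [hshare l h hp, if_pos hp]
      · simp only [hf, if_neg hp, mul_zero]
    rw [Finset.sum_congr rfl hterm, ← Finset.mul_sum]
    have hsum : ∑ l ∈ Finset.range (M + 1), (if (l, h) ∈ R then μ l / C l else 0)
        ≤ ∑ l ∈ Finset.range (M + 1),
          (if (1 ≤ l ∧ 2 * (l : ℝ) < T) then μ l / C l else 0) := by
      refine Finset.sum_le_sum fun l _ => ?_
      by_cases hp : (l, h) ∈ R
      · rw [if_pos hp, if_pos ⟨(hR _ hp).1, (hR _ hp).2.1⟩]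
      · rw [if_neg hp]
        split_ifs
        · exact div_nonneg (hμ0 l) (hC0 l)
        · exact le_rfl
    calc μ h * ∑ l ∈ Finset.range (M + 1), (if (l, h) ∈ R then μ l / C l else 0)
        ≤ μ h * 1 := mul_le_mul_of_nonneg_left (hsum.trans hload) (hμ0 h)
      _ = μ h := mul_one _

/-! ### One positive low atom (`2 < T ≤ 4`) -/

/-- **THE SINGLE-LOW FAN (`2 < T ≤ 4`).**  A probability law `μ` on `{0..M}` with mean `2 < T ≤ 4` (so the only positive low atom is `1`), floor
`0 < y < 1`, `y·M ≤ T`, and a finite set `H` of cost-safe compatible absorbers (`1 < h ≤ M`, `T < 1 + h`, `y·(h − 1) ≤ T − 1`) with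
**`μ(1) ≤ Σ_{h ∈ H} μ(h)/freeRate(1,h)`** is DEC at floor `y` at every layer `j′ < M` (atom `1` spread over `H` proportionally to the capacities;
`decAt_all_of_propFan` with `R = {1} × H`). [this work] -/
theorem decAt_all_of_oneLowFan (y : ℝ) (M : ℕ) (μ : ℕ → ℝ) (T : ℝ) (H : Finset ℕ) (hy0 : 0 < y) (hy1 : y < 1)
    (hμ0 : ∀ h, 0 ≤ μ h) (hμM : ∀ h, M < h → μ h = 0) (hμ1 : ∑ h ∈ Finset.range (M + 1), μ h = 1)
    (hT : ∑ h ∈ Finset.range (M + 1), (h : ℝ) * μ h = T) (hT2 : 2 < T) (hT4 : T ≤ 4) (hta : y * (M : ℝ) ≤ T)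
    (hH : ∀ h ∈ H, 1 < h ∧ h ≤ M ∧ T < 1 + (h : ℝ) ∧ y * ((h : ℝ) - 1) ≤ T - 1)
    (hcap : μ 1 ≤ ∑ h ∈ H, μ h / freeRate y T 1 h) :
    ∀ j', j' < M → DECAt y j' M μ := by
  classical
  set R : Finset (ℕ × ℕ) := H.image (fun h => (1, h)) with hRdef
  have hmemR : ∀ p, p ∈ R ↔ p.1 = 1 ∧ p.2 ∈ H := by
    intro p
    simp only [hRdef, Finset.mem_image]
    constructor
    · rintro ⟨h, hh, rfl⟩; exact ⟨rfl, hh⟩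
    · rintro ⟨h1, h2⟩; exact ⟨p.2, h2, by ext <;> simp [h1]⟩
  -- the capacity sum over `R` is the sum over `H`
  have hCsum : ∀ l, ∑ p ∈ R, (if p.1 = l then μ p.2 / freeRate y T p.1 p.2 else 0)
      = if l = 1 then ∑ h ∈ H, μ h / freeRate y T 1 h else 0 := by
    intro l
    rw [hRdef, Finset.sum_image (fun a _ b _ hab => by simpa using hab)]
    by_cases hl : l = 1
    · subst hl; simp
    · rw [if_neg hl]
      refine Finset.sum_eq_zero fun h _ => ?_
      rw [if_neg (fun h1 => hl h1.symm)]
  refine decAt_all_of_propFan y M μ T R hy0 hy1 hμ0 hμM hμ1 hT (by linarith) hta ?_ ?_ ?_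
  · intro p hp
    obtain ⟨hp1, hp2⟩ := (hmemR p).1 hp
    obtain ⟨a1, a2, a3, a4⟩ := hH p.2 hp2
    rw [hp1]
    refine ⟨le_rfl, by push_cast; linarith, a1, a2, by push_cast; linarith, by push_cast; linarith⟩
  · intro l hl1 hlow hpos
    have hl : l = 1 := by
      by_contra hne
      have : (2 : ℝ) ≤ l := by exact_mod_cast (show 2 ≤ l by omega)
      linarith
    subst hl
    rw [hCsum 1, if_pos rfl]
    exact lt_of_lt_of_le hpos hcap
  · -- the load sum has the single term `l = 1`
    have hone : ∀ l ∈ Finset.range (M + 1),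
        (if (1 ≤ l ∧ 2 * (l : ℝ) < T) then μ l / ∑ p ∈ R, (if p.1 = l then μ p.2 / freeRate y T p.1 p.2 else 0) else 0)
          = if l = 1 then μ 1 / ∑ h ∈ H, μ h / freeRate y T 1 h else 0 := by
      intro l _
      by_cases hl : l = 1
      · subst hl
        rw [if_pos ⟨le_rfl, by push_cast; linarith⟩, hCsum 1, if_pos rfl, if_pos rfl]
      · rw [if_neg hl]
        split_ifs with hc
        · exfalso
          have h2 : 2 ≤ l := by omega
          have : (2 : ℝ) ≤ l := by exact_mod_cast h2
          linarith [hc.2]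
        · rfl
    rw [Finset.sum_congr rfl hone, Finset.sum_ite_eq' (Finset.range (M + 1)) 1]
    have hM1 : 1 ∈ Finset.range (M + 1) := by
      rw [Finset.mem_range]
      -- `M ≥ 1` since `y·M ≤ T` does not give it; use the mean: `T > 2` forces an atom `≥ 1`, hence `M ≥ 1`
      by_contra hM
      have hM0 : M = 0 := by omega
      subst hM0
      simp only [zero_add, Finset.range_one, Finset.sum_singleton, Nat.cast_zero, zero_mul] at hT
      linarith
    rw [if_pos hM1]
    rcases (hμ0 1).eq_or_lt with hz | hpos
    · rw [← hz, zero_div]; norm_num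
    · have hS : 0 < ∑ h ∈ H, μ h / freeRate y T 1 h := lt_of_lt_of_le hpos hcap
      rw [div_le_one hS]; exact hcap


/-- **THE k-FREE RULE "ALL COST-SAFE ROUTES" (`2 < T ≤ 4`).**  With `H` = every compatible cost-safe absorber of the atom `1` in `{0..M}`
(`T < 1 + h`, `y·(h − 1) ≤ T − 1`), the single capacity inequality `μ(1) ≤ Σ_{h ∈ H} μ(h)/freeRate(1,h)` gives DEC at every layer.  This is the
closed-form certificate the census (kit j276490) finds feasible for every forest of 2-chains of every width in the regime `2 < T ≤ 4`. [this work] -/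
theorem decAt_all_of_safeFan (y : ℝ) (M : ℕ) (μ : ℕ → ℝ) (T : ℝ) (hy0 : 0 < y) (hy1 : y < 1)
    (hμ0 : ∀ h, 0 ≤ μ h) (hμM : ∀ h, M < h → μ h = 0) (hμ1 : ∑ h ∈ Finset.range (M + 1), μ h = 1)
    (hT : ∑ h ∈ Finset.range (M + 1), (h : ℝ) * μ h = T) (hT2 : 2 < T) (hT4 : T ≤ 4) (hta : y * (M : ℝ) ≤ T)
    (hcap : μ 1 ≤ ∑ h ∈ (Finset.range (M + 1)).filter (fun h : ℕ => 1 < h ∧ T < 1 + (h : ℝ) ∧ y * ((h : ℝ) - 1) ≤ T - 1),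
      μ h / freeRate y T 1 h) :
    ∀ j', j' < M → DECAt y j' M μ := by
  refine decAt_all_of_oneLowFan y M μ T _ hy0 hy1 hμ0 hμM hμ1 hT hT2 hT4 hta (fun h hh => ?_) hcap
  rw [Finset.mem_filter, Finset.mem_range] at hh
  exact ⟨hh.2.1, by omega, hh.2.2.1, hh.2.2.2⟩

/-! ### Forest form: the node's obligation at one gate -/

/-- the gated law at a positive atom: `gate μ a h = a·μ h` for `h ≠ 0`. [this work] -/
theorem gate_apply_of_ne_zero (μ : ℕ → ℝ) (a : ℝ) {h : ℕ} (hh : h ≠ 0) : gate μ a h = a * μ h := by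
  rw [gate_apply, if_neg hh, mul_zero, add_zero]

/-- **THE SINGLE-LOW FAN FOR A FOREST AT GATE `a` (the sibling step's obligation at that gate, directly).**  Law-OK siblings `L` (`0 < qᵢ < 1`, `ρᵢ`
probability laws), floor `0 < x` with `x·ftop L ≤ fmean L`, outer gate `0 < a ≤ 1` with `a·x < 1` and `2 < a·fmean L ≤ 4`; a finite set `H` of
absorbers compatible and cost-safe at `(y, T) = (a·x, a·fmean L)`; and the capacity inequality ON THE UNGATED FOREST LAW
`flaw L 1 ≤ Σ_{h ∈ H} flaw L h / freeRate (a·x) (a·fmean L) 1 h` (the gate `a` cancels).  Then `gate (flaw L) a` is DEC at `a·x` at every layer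
below the top.  No oracle, no residual split, any width. [this work] -/
theorem decAt_gate_flaw_of_oneLowFan {x a : ℝ} (hx0 : 0 < x) (ha0 : 0 < a) (ha1 : a ≤ 1) (hax1 : a * x < 1) (L : List Sib)
    (hL : ∀ s ∈ L, s.LawOK) (htop : x * (ftop L : ℝ) ≤ fmean L) (hT2 : 2 < a * fmean L) (hT4 : a * fmean L ≤ 4)
    (H : Finset ℕ)
    (hH : ∀ h ∈ H, 1 < h ∧ h ≤ ftop L ∧ a * fmean L < 1 + (h : ℝ) ∧ (a * x) * ((h : ℝ) - 1) ≤ a * fmean L - 1)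
    (hcap : flaw L 1 ≤ ∑ h ∈ H, flaw L h / freeRate (a * x) (a * fmean L) 1 h) :
    ∀ j, j < ftop L → DECAt (a * x) j (ftop L) (gate (flaw L) a) := by
  obtain ⟨f0, fM, f1, fmn⟩ := flaw_facts L hL
  obtain ⟨g0, gM, g1⟩ := gate_laws (ftop L) (flaw L) a ha0.le ha1 f0 fM f1
  have gmn : ∑ h ∈ Finset.range (ftop L + 1), (h : ℝ) * gate (flaw L) a h = a * fmean L := by rw [sum_mul_gate, fmn]
  refine decAt_all_of_oneLowFan (a * x) (ftop L) (gate (flaw L) a) (a * fmean L) H (mul_pos ha0 hx0) hax1 g0 gM g1 gmn hT2 hT4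
    (by nlinarith [mul_le_mul_of_nonneg_left htop ha0.le]) hH ?_
  rw [gate_apply_of_ne_zero _ _ one_ne_zero]
  have hrw : ∀ h ∈ H, gate (flaw L) a h / freeRate (a * x) (a * fmean L) 1 h = a * (flaw L h / freeRate (a * x) (a * fmean L) 1 h) := by
    intro h hh
    rw [gate_apply_of_ne_zero _ _ (by have := (hH h hh).1; omega)]
    ring
  rw [Finset.sum_congr rfl hrw, ← Finset.mul_sum]
  exact mul_le_mul_of_nonneg_left hcap ha0.le

end LawDec
end Quant
end Summit.CriticalPhenomena.PercolationContinuityZ3.Theorems
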